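import Literature.Geometry.Lorentzian.TameChartCompactness
import Literature.Geometry.Lorentzian.NearMinkowskiChartLateChart
import HarnessLib

/-!
# The class of uniformly tame near-Minkowski chart spacetimes is sequentially compact

The limit objects of local Cheeger–Gromov compactness — near-Minkowski chart spacetimes
`(O, G, ∂₀)` with `‖G − η‖ ≤ θ < 1` and `supCkENorm O k (G − η) ≤ Λ_k` for every `k` — form a class
which is itself SEQUENTIALLY COMPACT for pointed `Cᵏ_loc` convergence (all `k` at once, common base
point): apply the producer (`TameChartCompactness.lean`) with the identity charts, whose deviations
are `Gₙ − η` (`NearMinkowskiChartLateChart.lean`). With the algebra of limits (`trans`, `hull_closed`,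
…) this makes hulls / ω-limit sets inside the class compact invariant families, the setting in which
minimal elements exist (Birkhoff).

## References
* P. Petersen, *Riemannian Geometry*, 2nd ed., GTM 171, Springer 2006, Ch. 10, §3.2 (the class is
  compact). [Petersen2006]
-/

noncomputable section

open Set Metric Filter Topology Function TopologicalSpace
open scoped Manifold ContDiff Topology ENNReal

namespace Literature.Geometry.Lorentzian

namespace NearMinkowskiChart

variable {O : Opens E4}

/-- **Sequential compactness of the class of uniformly tame near-Minkowski chart spacetimes**
(module docstring). [cite: Petersen2006, Ch. 10 §3.2] -/
theorem exists_subconvergesLocallyTo_of_uniform (hO : IsConnected (O : Set E4)) {y₀ : E4}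
    (hy₀ : y₀ ∈ (O : Set E4)) (Lₙ : ℕ → NearMinkowskiChart O) {θ : ℝ} (hθ : θ < 1)
    (hpinch : ∀ n, ∀ y ∈ (O : Set E4), ‖(Lₙ n).G y - Minkowski.bilin‖ ≤ θ)
    (hbound : ∀ k : ℕ, ∃ Λ : ℝ≥0∞, Λ ≠ ⊤ ∧
      ∀ n, supCkENorm (O : Set E4) k ((Lₙ n).G - fun _ ↦ Minkowski.bilin) ≤ Λ) :
    ∃ (L : NearMinkowskiChart O) (φ : ℕ → ℕ), StrictMono φ ∧
      (∀ y ∈ (O : Set E4), ‖L.G y - Minkowski.bilin‖ ≤ θ) ∧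
      (∀ (k : ℕ) (C : ℝ≥0∞), (∀ n, supCkENorm (O : Set E4) k ((Lₙ n).G - fun _ ↦ Minkowski.bilin) ≤ C) →
        supCkENorm (O : Set E4) k (L.G - fun _ ↦ Minkowski.bilin) ≤ C) ∧
      (∀ (k : ℕ), ∀ K ⊆ (O : Set E4), IsCompact K →
        Tendsto (fun j ↦ supCkENorm K k ((Lₙ (φ j)).G - L.G)) atTop (𝓝 0)) ∧
      ∀ k : ℕ, Spacetime.SubconvergesLocallyTo (fun n ↦ (Lₙ n).spacetime hO) (fun _ ↦ ⟨y₀, hy₀⟩)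
        (L.spacetime hO) ⟨y₀, hy₀⟩ k := by
  -- the identity charts: deviation `Gₙ − η`
  have hsup : ∀ n (K : Set E4), K ⊆ (O : Set E4) → ∀ k, supCkENorm K k
      (((Lₙ n).spacetime hO).deviationExtend (Minkowski.backgroundOn O)
        (id : O → ((Lₙ n).spacetime hO).carrier)) =
      supCkENorm K k ((Lₙ n).G - fun _ ↦ Minkowski.bilin) :=
    fun n K hK k ↦ (Lₙ n).supCkENorm_deviationExtend_id hO hK k
  obtain ⟨L, φ, hφ, h1, h2, h3, h4⟩ := Spacetime.exists_nearMinkowskiChart_subconvergesLocallyTo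
    (𝓢ₙ := fun n ↦ (Lₙ n).spacetime hO) (pₙ := fun _ ↦ ⟨y₀, hy₀⟩) hO hy₀
    (fun n ↦ (id : O → ((Lₙ n).spacetime hO).carrier)) (fun _ ↦ contMDiff_id)
    (fun _ ↦ injective_id) (fun _ ↦ rfl)
    (fun n ↦ by
      have hid : mfderiv 𝓘(ℝ, E4) (𝓡 4) (id : O → ((Lₙ n).spacetime hO).carrier) ⟨y₀, hy₀⟩ =
          ContinuousLinearMap.id ℝ E4 := mfderiv_id
      have h := ((Lₙ n).spacetime hO).timeOrientation.isFutureDirected_vectorField ⟨y₀, hy₀⟩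
      exact hid ▸ h)
    hθ
    (fun n y hy ↦ by
      rw [(Lₙ n).deviationExtend_id_of_mem hO hy]
      exact hpinch n y hy)
    fun k ↦ (hbound k).imp fun Λ hΛ ↦ ⟨hΛ.1, fun n ↦ (hsup n O subset_rfl k).trans_le (hΛ.2 n)⟩
  refine ⟨L, φ, hφ, h1, fun k C hC ↦ h2 k C fun n ↦ (hsup n O subset_rfl k).trans_le (hC n), ?_, h4⟩
  intro k K hKO hK
  refine (h3 k K hKO hK).congr fun j ↦ supCkENorm_congr fun y hy ↦ ?_
  filter_upwards [(Lₙ (φ j)).deviationExtend_id_eventuallyEq hO (hKO hy)] with z hz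
  rw [Pi.sub_apply, Pi.sub_apply, hz]
  ext v w
  simp only [Pi.sub_apply, sub_apply]
  ring

end NearMinkowskiChart

end Literature.Geometry.Lorentzian

end
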